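import Summits.BirchSwinnertonDyer.Rank1Residual.P2.CongruentNumberPrimeSevenModEightMonskyDescent
import Literature.NumberTheory.EllipticCurves.Tian2014.CMPointSystemDescentPrimeFive
import HarnessLib

/-!
# Cell «bsd-monsky» (prover-A, g14): ROUTE A AT ONE PRIME — `N = p ≡ 5 (mod 8)` (Monsky's `p₅`, Cor. 5.15 (1)),
# from Tian's printed `n ≡ 1 (mod 4)` CM-point system alone: Tian Prop. 4.2 = Monsky Thm. 3.6 for Tian's point
# `2y_{p}`; rank `E_p(ℚ) = 1`, `p` congruent, `Ш(E_p)[2^∞] = 0`, odd index — and COR. 5.15 (1) COMPLETE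

HONEST FRAMING (cell `bsd-monsky`, run/shared/lean/pub/bsd-monsky/, README §1: ONE theorem on ONE explicit infinite
family at the prime `2`; nothing booked). This file asserts NO arithmetic fact and claims NOTHING new on paper: that
every prime `p ≡ 5 (mod 8)` is a congruent number is classical (Heegner 1952 / Birch 1968 / Stephens 1975; Monsky
1990 Thm. 3.6 and Cor. 5.15 (1) «`p₅`»; Tian 2014 Prop. 4.2, "When `k = 0` the above theorem is due to Monsky [19]").
The cell's route A transplanted Monsky's TWO-PRIME descent onto Tian's points, and g13 the one-prime cases `2p₃`,
`2p₇`, `p₇` of the `n ≡ 3 (mod 4)` system (Tian Prop. 4.6); this file transplants the ONE-PRIME BASE CASE of Tian's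
OTHER induction (Thm. 4.1: "It holds when `k = 0` by Proposition [4.2]"), for `p ≡ 5 (mod 8)` on the `n ≡ 1 (mod 4)`
system `CMPointDataOne` (Thm. 2.4), and records the consequences from the PRINTED SYSTEM BINDER alone —
`hSk₅ : ∀ p ≡ 5 (8) prime, ∃ D : CMPointDataOne p, D.Printed ∧ (∃ θ = √p ∈ H, conj θ = θ ∧ ∀ s, σ_s θ = θ ↔ s ∈ 2𝒜) ∧ i ∉ H`
(Tian 2014 Thm. 2.4 (2)–(3), Def. 2.3, the generation sentence and the order of `[ϖ]` — the displays of
`CMPointSystemOneModFour` — plus the §4.1 sentences "`K(√p₀) = H₀`", "`2𝒜 ≅ Gal(H/H₀)`", the real `√p₀` fixed by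
complex conjugation, and "`i ∉ H`"; binder form, no new named fact; no Gross–Zagier display, no `2`-Selmer display, no
genus display — "`2𝒜` has odd cardinality" and "`#𝒜[2] = 2`" are KERNEL THEOREMS of Rédei–Reichardt + Gauss in the tree):
* (M-2y) a RATIONAL point `y″ ∈ E_p(ℚ)` with `transfer y″ = 2y_p` (the real twist `E(ℚ(√p))⁻ ≅ E_p(ℚ)`) and
  `y″ ∉ 2E_p(ℚ) + E_p(ℚ)_tor` (`Tian2014.CMPointDataOne.exists_transferPos_eq_two_nsmul_yZero_not_two_smul_add_torsion_prime_five_mod_eight`);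
* rank `E_p(ℚ) = 1` (`y″` non-torsion; `≤ 1` = «`S̄ = ℤ/2`» on the Cor. 5.15 family `p₅`, the tree's exact count
  `#Sel₂(E_p) = 8`, p528474); `p` is a congruent number; `Ш(E_p)[2^∞] = 0`; `y″` has ODD INDEX against every
  generator of `E_p(ℚ)/tor`;
* `cor515_one_of_printed`: **Monsky's Cor. 5.15 (1) «`p₅, p₇, 2p₇ and 2p₃`» COMPLETE for Tian's points**, from the three
  printed binders (g13's `hSk₁`, `hSk₇` and this file's `hSk₅`) — rank one and congruent on all four one-prime families.
In the tree the family `p₅` was so far reached through Li–Liu–Tian 2024 Thm. 1.2 (full BSD relative to `hLLT`) and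
through TYZ's criterion (DOOR A, {`hTYZ`, GZK}; g11's `CongruentNumberCor515Displays`); this is a Gross–Zagier-free
proof of rank one there, by Monsky's own route on Tian's points. Nothing is asserted unconditionally beyond the tree's
own descent theorems.
[cite: Tian2014, Prop. 4.2 (arXiv:1210.8231 p0019 L74–L81) and its proof (p0020 L2–L23), Thm. 4.1 (p0019 L65–L70)]
[cite: Monsky1990MockHeegner, Thm. 3.6 (p. 53), Cor. 5.15 (1) (p. 66), Remark (2) (p. 67)]
[cite: SilvermanAEC2009, Thm. X.4.2, Thm. VIII.6.7] [cite: TopYui2008Congruent, Prop. 3.3 (i) ⟺ (iv)]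
-/

noncomputable section

open scoped Classical NumberTheorySymbols

open WeierstrassCurve NumberField Literature.NumberTheory.EllipticCurves
  Literature.NumberTheory.EllipticCurves.Rank1Residual
  Literature.NumberTheory.EllipticCurves.Rank1Residual.Typed
  Literature.NumberTheory.EllipticCurves.Monsky1990
  Literature.NumberTheory.EllipticCurves.TianYuanZhang2017

set_option autoImplicit false

namespace Summit.BirchSwinnertonDyer.Rank1Residual.P2

open Conjectures Literature.NumberTheory.EllipticCurves.Tian2014

/-! ## §1 The family `p₅` is a Cor. 5.15 family -/

/-- **A prime `p ≡ 5 (8)` is Monsky's family `p₅` of Cor. 5.15 (1)**.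
[cite: Monsky1990MockHeegner, Cor. 5.15 (1) (p. 66)] -/
theorem isCor515Family_five_mod_eight {p : ℕ} (hp : p.Prime) (hp8 : p % 8 = 5) : IsCor515Family p :=
  Or.inl ⟨hp, Or.inl hp8⟩

/-! ## §2 Rank one, congruent, `Ш[2^∞] = 0` and the odd index on `p₅` from the printed system binder -/

/-- **Rank `E_p(ℚ) = 1` for every prime `p ≡ 5 (mod 8)` from the printed system binder alone** (Tian Prop. 4.2 = Monsky
Thm. 3.6 transplanted: `2y_p` is the transfer along `√p` of a rational point `y″ ∉ 2E + tor`, so `rank ≥ 1`; `rank ≤ 1`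
is the tree's exact count `#Sel₂(E_p) = 8` on the Cor. 5.15 family `p₅`). No Gross–Zagier input.
[cite: Tian2014, Prop. 4.2 (p0019 L74–L81)] [cite: Monsky1990MockHeegner, Thm. 3.6 (p. 53), Cor. 5.15 (1) (p. 66)]
[cite: SilvermanAEC2009, Thm. X.4.2] -/
theorem mordellWeilRank_eq_one_five_mod_eight_of_printed
    (hSk₅ : ∀ p : ℕ, p.Prime → p % 8 = 5 →
      ∃ D : CMPointDataOne p, D.Printed ∧
        (∃ θ : D.H, θ ^ 2 = (p : D.H) ∧ D.conj θ = θ ∧ ∀ s, D.art s θ = θ ↔ IsSquare s) ∧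
        ∀ x : D.H, x ^ 2 ≠ -1) :
    ∀ p : ℕ, p.Prime → p % 8 = 5 → (congruentNumberCurve p).mordellWeilRank = 1 := by
  intro p hp hp8
  have hN : IsCor515Family p := isCor515Family_five_mod_eight hp hp8
  haveI := isElliptic_congruentNumberCurve hN.ne_zero
  obtain ⟨D, hP, ⟨θ, hθ, hconjθ, hartθ⟩, hnoI⟩ := hSk₅ p hp hp8
  obtain ⟨y'', -, hnot⟩ :=
    D.exists_transferPos_eq_two_nsmul_yZero_not_two_smul_add_torsion_prime_five_mod_eight hp hp8 hP hθ hconjθ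
      hartθ hnoI
  exact le_antisymm (mordellWeilRank_le_one_of_isCor515Family hN)
    (Nat.one_le_iff_ne_zero.mpr (mordellWeilRank_ne_zero_of_not_two_smul_add_torsion hN.ne_zero y'' hnot))

/-- **Every prime `p ≡ 5 (mod 8)` is a congruent number from the printed system binder alone** (Cor. 5.15 (1) «`p₅`»;
"In particular, `2y_{p₀} ∈ E(ℚ(√p₀))⁻` is of infinite order and therefore `p₀` is a congruent number").
[cite: Tian2014, Prop. 4.2 (p0019 L80–L81)] [cite: Monsky1990MockHeegner, Cor. 5.15 (1) (p. 66)]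
[cite: TopYui2008Congruent, Prop. 3.3 (i) ⟺ (iv)] -/
theorem isCongruentNumber_five_mod_eight_of_printed
    (hSk₅ : ∀ p : ℕ, p.Prime → p % 8 = 5 →
      ∃ D : CMPointDataOne p, D.Printed ∧
        (∃ θ : D.H, θ ^ 2 = (p : D.H) ∧ D.conj θ = θ ∧ ∀ s, D.art s θ = θ ↔ IsSquare s) ∧
        ∀ x : D.H, x ^ 2 ≠ -1) :
    ∀ p : ℕ, p.Prime → p % 8 = 5 → IsCongruentNumber p :=
  fun p hp hp8 =>
    (Wiles2000.mordellWeilRank_ne_zero_iff_isCongruentNumber (by have := hp.pos; omega)).mp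
      (by rw [mordellWeilRank_eq_one_five_mod_eight_of_printed hSk₅ p hp hp8]; exact one_ne_zero)

/-- **`Ш(E_p)[2^∞] = 0` for every prime `p ≡ 5 (mod 8)` from the printed system binder alone** (rank one and the exact
count `#Sel₂(E_p) = 8`). [cite: Monsky1990MockHeegner, Remark (2) (p. 67)] [cite: SilvermanAEC2009, Thm. X.4.2] -/
theorem primaryComponent_sha_two_eq_bot_five_mod_eight_of_printed
    (hSk₅ : ∀ p : ℕ, p.Prime → p % 8 = 5 →
      ∃ D : CMPointDataOne p, D.Printed ∧
        (∃ θ : D.H, θ ^ 2 = (p : D.H) ∧ D.conj θ = θ ∧ ∀ s, D.art s θ = θ ↔ IsSquare s) ∧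
        ∀ x : D.H, x ^ 2 ≠ -1) :
    ∀ p : ℕ, (hp : p.Prime) → p % 8 = 5 →
      haveI := isElliptic_congruentNumberCurve (n := p) hp.ne_zero
      AddCommGroup.primaryComponent (congruentNumberCurve p).sha 2 = ⊥ := by
  intro p hp hp8
  have hN : IsCor515Family p := isCor515Family_five_mod_eight hp hp8
  have h := (isCongruentNumber_iff_primaryComponent_sha_two_eq_bot_of_isCor515Family hN).mp
    (isCongruentNumber_five_mod_eight_of_printed hSk₅ p hp hp8)
  convert h

/-- **MONSKY'S THEOREM 3.6 FOR TIAN'S POINT `2y_p`, `p ≡ 5 (mod 8)`, from the printed system binder alone**: for every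
such `p` there are a printed system `D`, a square root `θ = √p ∈ H` with the two §4.1 sentences, `i ∉ H`, and a
rational point `y″ ∈ E_p(ℚ)` with `transfer_√p y″ = 2y_p`, of INFINITE ORDER and ODD INDEX against every generator of
`E_p(ℚ)/tor` ("`2y_{p₀} ∈ E(ℚ(√p₀))⁻ ∖ (2E(ℚ(√p₀))⁻ + E[2])`"). No `L`-function, no Gross–Zagier display, no `2`-Selmer
display, no reading mark. [cite: Tian2014, Prop. 4.2 (p0019 L74–L81)] [cite: Monsky1990MockHeegner, Thm. 3.6 (p. 53)] -/
theorem monskyOddIndex_five_mod_eight_of_printed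
    (hSk₅ : ∀ p : ℕ, p.Prime → p % 8 = 5 →
      ∃ D : CMPointDataOne p, D.Printed ∧
        (∃ θ : D.H, θ ^ 2 = (p : D.H) ∧ D.conj θ = θ ∧ ∀ s, D.art s θ = θ ↔ IsSquare s) ∧
        ∀ x : D.H, x ^ 2 ≠ -1) :
    ∀ p : ℕ, (hp : p.Prime) → p % 8 = 5 →
      ∃ D : CMPointDataOne p, D.Printed ∧ (∀ x : D.H, x ^ 2 ≠ -1) ∧
        ∃ (θ : D.H) (hθ : θ ^ 2 = (p : D.H)), D.conj θ = θ ∧ (∀ s, D.art s θ = θ ↔ IsSquare s) ∧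
          ∃ y'' : (congruentNumberCurve p).toAffine.Point,
            D.transferPos hp.ne_zero hθ y'' = (2 : ℕ) • D.yZero ∧ ¬ IsOfFinAddOrder y'' ∧
            (∀ g : (congruentNumberCurve p).toAffine.Point, GeneratesFreePartRat p g →
              ∃ m : ℤ, Odd m ∧ IsOfFinAddOrder (y'' - m • g)) := by
  intro p hp hp8
  obtain ⟨D, hP, ⟨θ, hθ, hconjθ, hartθ⟩, hnoI⟩ := hSk₅ p hp hp8
  obtain ⟨y'', hy'', hnot⟩ :=
    D.exists_transferPos_eq_two_nsmul_yZero_not_two_smul_add_torsion_prime_five_mod_eight hp hp8 hP hθ hconjθ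
      hartθ hnoI
  exact ⟨D, hP, hnoI, θ, hθ, hconjθ, hartθ, y'', hy'', not_isOfFinAddOrder_of_not_two_smul_add_torsion y'' hnot,
    fun g hg => exists_odd_isOfFinAddOrder_sub_zsmul_of_not_two_smul_add_torsion y'' hnot g hg⟩

/-! ## §3 Cor. 5.15 (1) complete: `p₅`, `p₇`, `2p₇`, `2p₃` for Tian's points from the printed binders -/

/-- **MONSKY'S COROLLARY 5.15 (1) «`p₅, p₇, 2p₇ and 2p₃` are congruent numbers» — COMPLETE for Tian's points, with rank
one, from the printed system binders**: `p₅` from this file's `hSk₅` (Thm. 2.4's system, Prop. 4.2 = Monsky Thm. 3.6),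
`p₇` and `2p₇` from g13's `hSk₇` (Thm. 2.8's system, Prop. 4.6 = Monsky Thm. 4.9), `2p₃` from g13's `hSk₁` (Prop. 4.6 =
Monsky Thm. 4.6) — the `k = 0` base cases of both of Tian's inductions; no Gross–Zagier input anywhere.
[cite: Monsky1990MockHeegner, Cor. 5.15 (1) (p. 66), Thm. 3.6 (p. 53), Thm. 4.6 (p. 57), Thm. 4.9 (p. 58)]
[cite: Tian2014, Prop. 4.2 (p0019 L74–L81), Prop. 4.6 (p0023 L15–L22), Thm. 4.1 (p0019 L65–L70), Thms. 4.4–4.5 (p0023 L3–L14)] -/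
theorem cor515_one_of_printed
    (hSk₁ : ∀ p : ℕ, p.Prime → p % 8 = 3 →
      ∃ D : CMPointData p, D.Printed ∧ ∀ s : D.H, s ^ 2 = 2 → D.tau s = s)
    (hSk₇ : ∀ p : ℕ, p.Prime → p % 8 = 7 →
      ∃ D : CMPointData p, D.Printed ∧ (∃ s : D.H, s ^ 2 = 2) ∧ (∀ s : D.H, s ^ 2 = 2 → D.tau s = s) ∧
        (∀ s : D.H, s ^ 2 = 2 → D.conj s = s) ∧ (∀ s : D.H, s ^ 2 = 2 → D.art D.piPrime s = s) ∧
        ∀ t : ClassGroup (𝓞 (GenusField (2 * p))), ¬ IsSquare t → ∀ s : D.H, s ^ 2 = 2 → D.art t s = -s)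
    (hSk₅ : ∀ p : ℕ, p.Prime → p % 8 = 5 →
      ∃ D : CMPointDataOne p, D.Printed ∧
        (∃ θ : D.H, θ ^ 2 = (p : D.H) ∧ D.conj θ = θ ∧ ∀ s, D.art s θ = θ ↔ IsSquare s) ∧
        ∀ x : D.H, x ^ 2 ≠ -1) :
    (∀ p : ℕ, p.Prime → p % 8 = 5 →
      (congruentNumberCurve p).mordellWeilRank = 1 ∧ IsCongruentNumber p) ∧
    (∀ p : ℕ, p.Prime → p % 8 = 7 →
      ((congruentNumberCurve p).mordellWeilRank = 1 ∧ IsCongruentNumber p) ∧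
      ((congruentNumberCurve (2 * p)).mordellWeilRank = 1 ∧ IsCongruentNumber (2 * p))) ∧
    ∀ p : ℕ, p.Prime → p % 8 = 3 →
      (congruentNumberCurve (2 * p)).mordellWeilRank = 1 ∧ IsCongruentNumber (2 * p) :=
  ⟨fun p hp hp8 => ⟨mordellWeilRank_eq_one_five_mod_eight_of_printed hSk₅ p hp hp8,
      isCongruentNumber_five_mod_eight_of_printed hSk₅ p hp hp8⟩,
    cor515_one_minus_five_of_printed hSk₁ hSk₇⟩

/-! ## §4 Route A's reach on Cor. 5.15, in one statement -/

/-- **MONSKY'S COR. 5.15 ON TIAN'S POINTS BY ROUTE A — what the printed skeleton binders give, in one statement**: rank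
one and congruent on ALL of (1) (`p₅`, `p₇`, `2p₇`, `2p₃` — the one-prime cases, this file and g13's), and in (2) on
`p₃p₅` and `2p₃p₅` for EITHER symbol (Monsky Thm. 5.5 both twists, g12's `monsky_thm55_both_twists_of_skeleton`) and on
`2p₅p₇` with `(p₅/p₇) = −1` (the silent half `(15)⁻` of the cell's enclosure, `mordellWeilRank_eq_one_of_skeleton_rankDescent`)
— five binders, all printed CM-point-system sentences, NO Gross–Zagier, NO `2`-Selmer display. NOT reached by the
mechanism (and why): the loud `2p₅p₇`, `(p₅/p₇) = +1` (`(15)⁺`, Monsky Thm. 5.9 (2): the real-locus Lemma 5.6 (2) and a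
ramification argument), `p₃p₇` (Thm. 3.9 (3): Lemmas 3.7–3.8, real locus + ramification), and all of (3) (`p₁p₅`,
`p₁p₇`, `2p₁p₇`, `2p₁p₃`: Thms. 3.9 (5), 4.11, 4.15, 5.9 (1) — ramification arguments; Tian's inductions need Thm. 3.3)
— none of these is on the skeleton. [cite: Monsky1990MockHeegner, Cor. 5.15 (p. 66), Thms. 3.6, 3.9, 4.6, 4.9, 5.5, 5.9 (pp. 53–64)]
[cite: Tian2014, Prop. 4.2 (p0019 L74–L81), Prop. 4.6 (p0023 L15–L22), Thm. 2.4 (p0008 L68–L74), Thm. 2.8 (p0011 L37–L44)] -/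
theorem cor515_routeA_of_printed
    (hSk₁ : ∀ p : ℕ, p.Prime → p % 8 = 3 →
      ∃ D : CMPointData p, D.Printed ∧ ∀ s : D.H, s ^ 2 = 2 → D.tau s = s)
    (hSk₇ : ∀ p : ℕ, p.Prime → p % 8 = 7 →
      ∃ D : CMPointData p, D.Printed ∧ (∃ s : D.H, s ^ 2 = 2) ∧ (∀ s : D.H, s ^ 2 = 2 → D.tau s = s) ∧
        (∀ s : D.H, s ^ 2 = 2 → D.conj s = s) ∧ (∀ s : D.H, s ^ 2 = 2 → D.art D.piPrime s = s) ∧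
        ∀ t : ClassGroup (𝓞 (GenusField (2 * p))), ¬ IsSquare t → ∀ s : D.H, s ^ 2 = 2 → D.art t s = -s)
    (hSk₅ : ∀ p : ℕ, p.Prime → p % 8 = 5 →
      ∃ D : CMPointDataOne p, D.Printed ∧
        (∃ θ : D.H, θ ^ 2 = (p : D.H) ∧ D.conj θ = θ ∧ ∀ s, D.art s θ = θ ↔ IsSquare s) ∧
        ∀ x : D.H, x ^ 2 ≠ -1)
    (hSk₃ : ∀ p q : ℕ, (hp : p.Prime) → (hq : q.Prime) → p % 8 = 5 → q % 8 = 3 →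
      ∃ D : CMPointData (p * q), D.PrintedCore ∧ D.GenusTheoryDisplaysCore)
    (hSkS : ∀ p q : ℕ, (hp : p.Prime) → (hq : q.Prime) → p % 8 = 5 → q % 4 = 3 → jacobiSym p q = -1 →
      ∃ D : CMPointData (p * q), D.PrintedCore ∧ D.GenusTheoryDisplaysCore) :
    -- Cor. 5.15 (1): `p₅`, `p₇`, `2p₇`, `2p₃`
    ((∀ p : ℕ, p.Prime → p % 8 = 5 →
      (congruentNumberCurve p).mordellWeilRank = 1 ∧ IsCongruentNumber p) ∧
    (∀ p : ℕ, p.Prime → p % 8 = 7 →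
      ((congruentNumberCurve p).mordellWeilRank = 1 ∧ IsCongruentNumber p) ∧
      ((congruentNumberCurve (2 * p)).mordellWeilRank = 1 ∧ IsCongruentNumber (2 * p))) ∧
    (∀ p : ℕ, p.Prime → p % 8 = 3 →
      (congruentNumberCurve (2 * p)).mordellWeilRank = 1 ∧ IsCongruentNumber (2 * p))) ∧
    -- Cor. 5.15 (2): `p₃p₅`, `2p₃p₅` (either symbol) and the silent `2p₅p₇`
    (∀ p q : ℕ, p.Prime → q.Prime → p % 8 = 5 → q % 8 = 3 →
      ((congruentNumberCurve (p * q)).mordellWeilRank = 1 ∧ IsCongruentNumber (p * q)) ∧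
      ((congruentNumberCurve (2 * (p * q))).mordellWeilRank = 1 ∧ IsCongruentNumber (2 * (p * q)))) ∧
    (∀ p q : ℕ, p.Prime → q.Prime → p % 8 = 5 → q % 8 = 7 → jacobiSym p q = -1 →
      (congruentNumberCurve (2 * (p * q))).mordellWeilRank = 1 ∧ IsCongruentNumber (2 * (p * q))) :=
  ⟨cor515_one_of_printed hSk₁ hSk₇ hSk₅, monsky_thm55_both_twists_of_skeleton hSk₃,
    fun p q hp hq hp5 hq7 hj =>
      ⟨mordellWeilRank_eq_one_of_skeleton_rankDescent hSkS p q hp hq hp5 (by omega) hj,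
        isCongruentNumber_two_mul_five_mul_of_skeleton hSkS p q hp hq hp5 (by omega) hj⟩⟩

end Summit.BirchSwinnertonDyer.Rank1Residual.P2

end
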